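import Summits.NavierStokesRegularity.NavierStokesRegularity.Theorems.LevelSetModerationHighSpeedPressureWorkSlabBounds
import Summits.NavierStokesRegularity.NavierStokesRegularity.Theorems.LevelSetModerationHighSpeedPressureWorkSliceMeasurability
import Summits.NavierStokesRegularity.NavierStokesRegularity.Theorems.LevelSetModerationHighSpeedPressureWorkCostCauchySchwarz

/-!
# Route LevelSetModeration — `HighSpeedPressureWork`: time-integrability of the line's slice functionals

Support file for item stmt-NavierStokesRegularity-18149 (clauses (iii)–(iv) of the registered stub
`stub_sliceRegularity` of line `Sketch`). For `ν > 0`, a classical solution `(u, p)` of the unforced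
Navier–Stokes system on `ℝ³ × [0,T)` that is Leray–Hopf on `[0,T]` from a rapidly decaying datum, a
level `c > 0`, `t ∈ [0,T)`, a frame `U`, a head level `K` and a continuous rate `r`:

* `levelSetModeration_integrableOn_gradSlice` — `τ ↦ ∫ 1_{|u(τ)|>c} ‖D|u(τ)|‖` is integrable on `(0,t)`;
* `levelSetModeration_integrableOn_deficitSlice` —
  `τ ↦ ∫ 1_{|u(τ)|>c} (c/|u|²)(-D|u|(u))₊ (K + ∫₀^τ r - (p + |u-U|²/2))` is integrable on `(0,t)`.

Both slice functionals are a.e.-strongly measurable in `τ` (Fubini for a density on `ℝ × ℝ³` that is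
continuous on the measurable, relatively open set `{c < |u|} ∩ slab`, the speed gradient being
`|u|⁻¹⟨u, Du·⟩` there) and uniformly bounded on `(0,t)` (slab bounds `‖u‖, |p| ≤ B`, `‖Du‖ ≤ L`,
`levelSetModeration_slabBounds` / `levelSetModeration_slice_fderiv_bound`, and the Chebyshev bound
`|{|u(τ)|>c}| ≤ 2E₀/c²`), hence integrable on the finite interval.
-/

noncomputable section

-- single-conjunct summit: `Summit.<Summit>.<Problem>` repeats the name by the D-0017 layout
set_option linter.dupNamespace false

namespace Summit.NavierStokesRegularity.NavierStokesRegularity.Theorems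

open MeasureTheory Set Filter Topology Function Metric
open scoped ENNReal RealInnerProductSpace
open Literature.Analysis.FluidPDE

section SliceIntegrability

variable {ν T : ℝ} {u : ℝ → EuclideanSpace ℝ (Fin 3) → EuclideanSpace ℝ (Fin 3)}
  {p : ℝ → EuclideanSpace ℝ (Fin 3) → ℝ}

/-- **A uniformly bounded, a.e.-strongly measurable slice functional is integrable on `(0, t)`.**
[folklore] -/
theorem levelSetModeration_integrableOn_Ioo_of_bound {f : ℝ → ℝ} {t C : ℝ}
    (hf : AEStronglyMeasurable f (volume.restrict (Ioo 0 t)))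
    (hC : ∀ᵐ τ ∂(volume.restrict (Ioo 0 t)), ‖f τ‖ ≤ C) : IntegrableOn f (Ioo 0 t) volume :=
  Integrable.mono' (integrable_const C) hf hC

/-- **The volume of the high-speed set of a slice is finite with a uniform real bound**: for
`τ ∈ [0,T]`, `c > 0`, `(volume {c < ‖u τ ·‖}).toReal ≤ 2E(u₀)/c²`. [folklore] -/
theorem levelSetModeration_toReal_volume_superlevel_le (hν : 0 ≤ ν) (hLH : IsLerayHopfOn T ν 0 (u 0) u)
    {τ : ℝ} (hτ : τ ∈ Icc 0 T) {c : ℝ} (hc : 0 < c) :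
    volume {x | c < ‖u τ x‖} ≠ ∞ ∧
      (volume {x | c < ‖u τ x‖}).toReal ≤ 2 * VectorCalculus.kineticEnergy (u 0) / c ^ 2 := by
  have h := levelSetModeration_volume_superlevel_le hν hLH hτ hc
  have hK : ENNReal.ofReal (2 * VectorCalculus.kineticEnergy (u 0)) / ENNReal.ofReal (c ^ 2) ≠ ∞ :=
    ENNReal.div_ne_top ENNReal.ofReal_ne_top ((ENNReal.ofReal_pos.2 (by positivity)).ne')
  refine ⟨ne_top_of_le_ne_top hK h, ?_⟩
  have hE0 : 0 ≤ 2 * VectorCalculus.kineticEnergy (u 0) :=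
    mul_nonneg zero_le_two (kineticEnergy_nonneg _)
  calc (volume {x | c < ‖u τ x‖}).toReal
      ≤ (ENNReal.ofReal (2 * VectorCalculus.kineticEnergy (u 0)) / ENNReal.ofReal (c ^ 2)).toReal :=
        ENNReal.toReal_mono hK h
    _ = 2 * VectorCalculus.kineticEnergy (u 0) / c ^ 2 := by
        rw [ENNReal.toReal_div, ENNReal.toReal_ofReal hE0, ENNReal.toReal_ofReal (by positivity)]

/-- **Bounding a slice integral supported in the high-speed set**: if `|g| ≤ C₀` on `A = {c < ‖w‖}`,
`g = 0` off `A`, and `|A| < ∞`, then `‖∫ g‖ ≤ C₀ |A|` (no integrability of `g` needed). [folklore] -/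
theorem levelSetModeration_norm_integral_le_of_superlevel
    {w : EuclideanSpace ℝ (Fin 3) → EuclideanSpace ℝ (Fin 3)} (hw : Continuous w) {c C₀ : ℝ}
    {g : EuclideanSpace ℝ (Fin 3) → ℝ} (hgA : ∀ x, c < ‖w x‖ → |g x| ≤ C₀)
    (hg0 : ∀ x, ¬ c < ‖w x‖ → g x = 0) (hV : volume {x | c < ‖w x‖} ≠ ∞) :
    ‖∫ x, g x‖ ≤ C₀ * (volume {x | c < ‖w x‖}).toReal := by
  set A : Set (EuclideanSpace ℝ (Fin 3)) := {x | c < ‖w x‖} with hA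
  have hA_meas : MeasurableSet A := (isOpen_lt continuous_const hw.norm).measurableSet
  haveI : IsFiniteMeasure (volume.restrict A) := isFiniteMeasure_restrict.2 hV
  have hmaj : Integrable (A.indicator fun _ => C₀) volume :=
    (integrable_indicator_iff hA_meas).2 (integrable_const C₀)
  calc ‖∫ x, g x‖ ≤ ∫ x, A.indicator (fun _ => C₀) x := by
        refine norm_integral_le_of_norm_le hmaj (Eventually.of_forall fun x => ?_)
        by_cases hx : x ∈ A
        · rw [indicator_of_mem hx, Real.norm_eq_abs]; exact hgA x hx
        · rw [indicator_of_notMem hx, hg0 x hx, norm_zero]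
    _ = C₀ * (volume A).toReal := by
        rw [integral_indicator hA_meas, setIntegral_const, smul_eq_mul, mul_comm]
        rfl

/-- **Time-integrability of the speed-gradient slice** (clause (iii) of `stub_sliceRegularity`):
`τ ↦ ∫ 1_{|u(τ)|>c} ‖D|u(τ)|‖` is integrable on `(0,t)`, `t < T`, `c > 0`. [cite: Tao2011, Cor. 11.1] -/
theorem levelSetModeration_integrableOn_gradSlice (hν : 0 < ν)
    (hcl : IsClassicalNSSolutionOn (Ico 0 T) ν 0 u p) (hLH : IsLerayHopfOn T ν 0 (u 0) u)
    (hdec : HasRapidSpatialDecay (u 0)) {c : ℝ} (hc : 0 < c) {t : ℝ} (ht : t ∈ Ico 0 T) :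
    IntegrableOn (fun τ => ∫ x, {x | c < ‖u τ x‖}.indicator
      (fun x => ‖fderiv ℝ (fun y => ‖u τ y‖) x‖) x) (Ioo 0 t) volume := by
  have hu := hcl.smooth_velocity
  -- slab bounds on `[0, T₁]`, `T₁ = (t+T)/2`
  have hT₁ : (t + T) / 2 ∈ Ioo 0 T := ⟨by linarith [ht.1, ht.2], by linarith [ht.2]⟩
  have htT₁ : t ≤ (t + T) / 2 := by linarith [ht.2]
  obtain ⟨L, hL⟩ := levelSetModeration_slice_fderiv_bound hν hcl hLH hdec hT₁
  have hL0 : 0 ≤ L := (norm_nonneg _).trans (hL 0 ⟨le_rfl, hT₁.1.le⟩ 0)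
  -- (a) a.e.-strong measurability via Fubini on the slab
  set Ω : Set (ℝ × EuclideanSpace ℝ (Fin 3)) := Ico 0 T ×ˢ univ with hΩ
  set W : Set (ℝ × EuclideanSpace ℝ (Fin 3)) := {z | z ∈ Ω ∧ c < ‖uncurry u z‖} with hW
  have hcontu : ContinuousOn (uncurry u) Ω := hu.continuousOn
  have hWmeas : MeasurableSet W := levelSetModeration_measurableSet_superlevel_slab hcontu c
  have hWΩ : W ⊆ Ω := fun z hz => hz.1
  set Dslab := fderivWithin ℝ (uncurry u) Ω with hDslab
  have hDcont : ContinuousOn Dslab Ω := (hu.contDiffOn_fderivWithin (uniqueDiffOn_Ico 0 T)).continuousOn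
  set G : ℝ × EuclideanSpace ℝ (Fin 3) → ℝ := fun z =>
    ‖(‖uncurry u z‖⁻¹ • innerSL ℝ (uncurry u z)).comp
      ((Dslab z).comp (ContinuousLinearMap.inr ℝ ℝ (EuclideanSpace ℝ (Fin 3))))‖ with hG
  have hGcont : ContinuousOn G W := by
    have hne : ∀ z ∈ W, ‖uncurry u z‖ ≠ 0 := fun z hz => (hc.trans hz.2).ne'
    have h1 : ContinuousOn (fun z => ‖uncurry u z‖⁻¹) W := (hcontu.mono hWΩ).norm.inv₀ hne
    have h2 : ContinuousOn (fun z => innerSL ℝ (uncurry u z)) W :=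
      (innerSL ℝ).continuous.comp_continuousOn (hcontu.mono hWΩ)
    have h3 : ContinuousOn (fun z => (Dslab z).comp
        (ContinuousLinearMap.inr ℝ ℝ (EuclideanSpace ℝ (Fin 3)))) W :=
      (hDcont.mono hWΩ).clm_comp continuousOn_const
    exact ((h1.smul h2).clm_comp h3).norm
  have hF : AEStronglyMeasurable (W.indicator G)
      ((volume.restrict (Ioo 0 t)).prod (volume : Measure (EuclideanSpace ℝ (Fin 3)))) :=
    ((aemeasurable_indicator_iff hWmeas).2 (hGcont.aemeasurable hWmeas)).aestronglyMeasurable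
  have hmeas0 := hF.integral_prod_right'
  -- identification of the sections for `τ ∈ (0, t)`
  have hsec : ∀ τ ∈ Ioo 0 t, (fun x => W.indicator G (τ, x)) =
      {x | c < ‖u τ x‖}.indicator fun x => ‖fderiv ℝ (fun y => ‖u τ y‖) x‖ := by
    intro τ hτ
    have hτ' : τ ∈ Ico 0 T := ⟨hτ.1.le, hτ.2.trans ht.2⟩
    funext x
    by_cases hx : c < ‖u τ x‖
    · have hzW : (τ, x) ∈ W := ⟨mk_mem_prod hτ' (mem_univ x), hx⟩
      rw [indicator_of_mem hzW, indicator_of_mem (show x ∈ {x | c < ‖u τ x‖} from hx), hG]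
      have hx0 : u τ x ≠ 0 := by
        intro h0; rw [h0, norm_zero] at hx; exact absurd hx (not_lt.2 hc.le)
      have hdu : DifferentiableAt ℝ (u τ) x := ((hu.contDiff_slice hτ').differentiable (by simp)) x
      have hchain : fderiv ℝ (fun y => ‖u τ y‖) x =
          (‖u τ x‖⁻¹ • innerSL ℝ (u τ x)).comp (fderiv ℝ (u τ) x) :=
        ((LevelSetEnergyInequality.hasFDerivAt_norm_of_ne_zero hx0).comp x hdu.hasFDerivAt).fderiv
      rw [hchain, hu.fderiv_slice_eq hτ' x]
      rfl
    · have hzW : (τ, x) ∉ W := fun h => hx h.2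
      rw [indicator_of_notMem hzW, indicator_of_notMem (show x ∉ {x | c < ‖u τ x‖} from hx)]
  have hmeas : AEStronglyMeasurable (fun τ => ∫ x, {x | c < ‖u τ x‖}.indicator
      (fun x => ‖fderiv ℝ (fun y => ‖u τ y‖) x‖) x) (volume.restrict (Ioo 0 t)) := by
    refine hmeas0.congr ?_
    filter_upwards [ae_restrict_mem measurableSet_Ioo] with τ hτ
    show (∫ x, W.indicator G (τ, x)) = _
    rw [hsec τ hτ]
  -- (b) the uniform bound `L · 2E₀/c²`
  refine levelSetModeration_integrableOn_Ioo_of_bound hmeas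
    (C := L * (2 * VectorCalculus.kineticEnergy (u 0) / c ^ 2)) ?_
  filter_upwards [ae_restrict_mem measurableSet_Ioo] with τ hτ
  have hτ' : τ ∈ Ico 0 T := ⟨hτ.1.le, hτ.2.trans ht.2⟩
  have hτ₁ : τ ∈ Icc 0 ((t + T) / 2) := ⟨hτ.1.le, hτ.2.le.trans htT₁⟩
  obtain ⟨hVfin, hVle⟩ := levelSetModeration_toReal_volume_superlevel_le hν.le hLH
    ⟨hτ'.1, hτ'.2.le⟩ hc
  have hdiff : Differentiable ℝ (u τ) := (hcl.contDiff_velocity hτ').differentiable (by simp)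
  have hbound := levelSetModeration_norm_integral_le_of_superlevel (hcl.contDiff_velocity hτ').continuous
    (C₀ := L) (g := {x | c < ‖u τ x‖}.indicator fun x => ‖fderiv ℝ (fun y => ‖u τ y‖) x‖)
    (fun x hx => by
      rw [indicator_of_mem (show x ∈ {x | c < ‖u τ x‖} from hx), abs_norm]
      have hx0 : u τ x ≠ 0 := by
        intro h0; rw [h0, norm_zero] at hx; exact absurd hx (not_lt.2 hc.le)
      exact (norm_fderiv_norm_comp_le (hdiff x) hx0).trans (hL τ hτ₁ x))
    (fun x hx => indicator_of_notMem (show x ∉ {x | c < ‖u τ x‖} from hx) _) hVfin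
  exact hbound.trans (mul_le_mul_of_nonneg_left hVle hL0)

/-- **Time-integrability of the head-deficit slice** (clause (iv) of `stub_sliceRegularity`): for a
frame `U`, a level `K` and a continuous rate `r`,
`τ ↦ ∫ 1_{|u(τ)|>c} (c/|u|²)(-D|u|(u))₊ (K + ∫₀^τ r - (p + |u-U|²/2))` is integrable on `(0,t)`.
[cite: Tao2011, Cor. 11.1 and Lemma 4.1 (i)] -/
theorem levelSetModeration_integrableOn_deficitSlice (hν : 0 < ν)
    (hcl : IsClassicalNSSolutionOn (Ico 0 T) ν 0 u p) (hLH : IsLerayHopfOn T ν 0 (u 0) u)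
    (hdec : HasRapidSpatialDecay (u 0)) {c : ℝ} (hc : 0 < c) {t : ℝ} (ht : t ∈ Ico 0 T)
    (U : EuclideanSpace ℝ (Fin 3)) (K : ℝ) {r : ℝ → ℝ} (hr : Continuous r) :
    IntegrableOn (fun τ => ∫ x, {x | c < ‖u τ x‖}.indicator (fun x => c / ‖u τ x‖ ^ 2 *
      max (-(fderiv ℝ (fun y => ‖u τ y‖) x (u τ x))) 0 *
        (K + (∫ σ in Ioo 0 τ, r σ) - (p τ x + ‖u τ x - U‖ ^ 2 / 2))) x) (Ioo 0 t) volume := by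
  have hu := hcl.smooth_velocity
  have hp := hcl.smooth_pressure
  -- slab bounds
  have hT₁ : (t + T) / 2 ∈ Ioo 0 T := ⟨by linarith [ht.1, ht.2], by linarith [ht.2]⟩
  have htT₁ : t ≤ (t + T) / 2 := by linarith [ht.2]
  obtain ⟨L, hL⟩ := levelSetModeration_slice_fderiv_bound hν hcl hLH hdec hT₁
  have hL0 : 0 ≤ L := (norm_nonneg _).trans (hL 0 ⟨le_rfl, hT₁.1.le⟩ 0)
  obtain ⟨B, hB⟩ := levelSetModeration_slabBounds ν T u p hν hcl hLH hdec t ht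
  have hB0 : 0 ≤ B := (norm_nonneg _).trans (hB 0 ⟨le_rfl, ht.1⟩ 0).1
  -- a bound for `r` on `[0, t]` and for its primitive
  obtain ⟨R, hR⟩ := isCompact_Icc.exists_bound_of_continuousOn (s := Icc 0 t) hr.continuousOn
  have hR0 : 0 ≤ R := (norm_nonneg _).trans (hR 0 ⟨le_rfl, ht.1⟩)
  have hIr : ∀ τ ∈ Icc 0 t, |∫ σ in Ioo 0 τ, r σ| ≤ R * t := by
    intro τ hτ
    have h1 : ‖∫ σ in Ioo 0 τ, r σ‖ ≤ R * (volume (Ioo 0 τ)).toReal := by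
      refine norm_setIntegral_le_of_norm_le_const (measure_Ioo_lt_top) fun σ hσ => ?_
      exact hR σ ⟨hσ.1.le, hσ.2.le.trans hτ.2⟩
    rw [Real.volume_Ioo, ENNReal.toReal_ofReal (by linarith [hτ.1])] at h1
    rw [← Real.norm_eq_abs]
    calc ‖∫ σ in Ioo 0 τ, r σ‖ ≤ R * (τ - 0) := h1
      _ ≤ R * t := by rw [sub_zero]; exact mul_le_mul_of_nonneg_left hτ.2 hR0
  -- the uniform pointwise bound on the high-speed set
  have ht0 : 0 ≤ t := ht.1
  set C₀ : ℝ := (1 / c) * (L * B) * (|K| + R * t + (B + (B + ‖U‖) ^ 2 / 2)) with hC₀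
  have hC₀0 : 0 ≤ C₀ := by positivity
  -- (a) a.e.-strong measurability via Fubini on the slab
  set Ω : Set (ℝ × EuclideanSpace ℝ (Fin 3)) := Ico 0 T ×ˢ univ with hΩ
  set W : Set (ℝ × EuclideanSpace ℝ (Fin 3)) := {z | z ∈ Ω ∧ c < ‖uncurry u z‖} with hW
  have hcontu : ContinuousOn (uncurry u) Ω := hu.continuousOn
  have hcontp : ContinuousOn (uncurry p) Ω := hp.continuousOn
  have hWmeas : MeasurableSet W := levelSetModeration_measurableSet_superlevel_slab hcontu c
  have hWΩ : W ⊆ Ω := fun z hz => hz.1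
  set Dslab := fderivWithin ℝ (uncurry u) Ω with hDslab
  have hDcont : ContinuousOn Dslab Ω := (hu.contDiffOn_fderivWithin (uniqueDiffOn_Ico 0 T)).continuousOn
  -- the primitive of `r` as a continuous function of `τ`
  set Ir : ℝ → ℝ := fun τ => ∫ σ in (0 : ℝ)..τ, r σ with hIrdef
  have hIr_cont : Continuous Ir :=
    intervalIntegral.continuous_primitive (fun a b => hr.intervalIntegrable a b) 0
  have hIr_eq : ∀ τ, 0 ≤ τ → (∫ σ in Ioo 0 τ, r σ) = Ir τ := by
    intro τ hτ
    rw [hIrdef]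
    simp only []
    rw [intervalIntegral.integral_of_le hτ, integral_Ioc_eq_integral_Ioo]
  -- the density on `ℝ × ℝ³`
  set dn : ℝ × EuclideanSpace ℝ (Fin 3) → ℝ := fun z =>
    ‖uncurry u z‖⁻¹ * ⟪uncurry u z, (Dslab z) ((0 : ℝ), uncurry u z)⟫ with hdn
  set G : ℝ × EuclideanSpace ℝ (Fin 3) → ℝ := fun z =>
    c / ‖uncurry u z‖ ^ 2 * max (-(dn z)) 0 *
      (K + Ir z.1 - (uncurry p z + ‖uncurry u z - U‖ ^ 2 / 2)) with hG
  have hGcont : ContinuousOn G W := by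
    have hne : ∀ z ∈ W, ‖uncurry u z‖ ≠ 0 := fun z hz => (hc.trans hz.2).ne'
    have huW := hcontu.mono hWΩ
    have h1 : ContinuousOn (fun z => c / ‖uncurry u z‖ ^ 2) W :=
      continuousOn_const.div (huW.norm.pow 2) fun z hz => pow_ne_zero 2 (hne z hz)
    have h2 : ContinuousOn dn W := by
      have ha : ContinuousOn (fun z => (Dslab z) ((0 : ℝ), uncurry u z)) W :=
        (hDcont.mono hWΩ).clm_apply (continuousOn_const.prodMk huW)
      exact (huW.norm.inv₀ hne).mul (huW.inner ha)
    have h3 : ContinuousOn (fun z : ℝ × EuclideanSpace ℝ (Fin 3) =>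
        K + Ir z.1 - (uncurry p z + ‖uncurry u z - U‖ ^ 2 / 2)) W := by
      refine (continuousOn_const.add (hIr_cont.comp_continuousOn continuous_fst.continuousOn)).sub
        ((hcontp.mono hWΩ).add ?_)
      exact ((huW.sub continuousOn_const).norm.pow 2).div_const _
    exact (h1.mul ((continuous_id.max continuous_const).comp_continuousOn (ContinuousOn.neg h2))).mul h3
  have hF : AEStronglyMeasurable (W.indicator G)
      ((volume.restrict (Ioo 0 t)).prod (volume : Measure (EuclideanSpace ℝ (Fin 3)))) :=
    ((aemeasurable_indicator_iff hWmeas).2 (hGcont.aemeasurable hWmeas)).aestronglyMeasurable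
  have hmeas0 := hF.integral_prod_right'
  -- the sections
  have hdn_eq : ∀ τ ∈ Ico 0 T, ∀ x, c < ‖u τ x‖ →
      dn (τ, x) = fderiv ℝ (fun y => ‖u τ y‖) x (u τ x) := by
    intro τ hτ' x hx
    have hx0 : u τ x ≠ 0 := by
      intro h0; rw [h0, norm_zero] at hx; exact absurd hx (not_lt.2 hc.le)
    have hdu : DifferentiableAt ℝ (u τ) x := ((hu.contDiff_slice hτ').differentiable (by simp)) x
    have hchain : fderiv ℝ (fun y => ‖u τ y‖) x =
        (‖u τ x‖⁻¹ • innerSL ℝ (u τ x)).comp (fderiv ℝ (u τ) x) :=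
      ((LevelSetEnergyInequality.hasFDerivAt_norm_of_ne_zero hx0).comp x hdu.hasFDerivAt).fderiv
    rw [hchain, hu.fderiv_slice_eq hτ' x]
    show ‖u τ x‖⁻¹ * ⟪u τ x, (Dslab (τ, x)) ((0 : ℝ), u τ x)⟫ = _
    simp only [ContinuousLinearMap.comp_apply, ContinuousLinearMap.inr_apply,
      smul_apply, innerSL_apply_apply, smul_eq_mul]
    rfl
  have hsec : ∀ τ ∈ Ioo 0 t, (fun x => W.indicator G (τ, x)) =
      {x | c < ‖u τ x‖}.indicator fun x => c / ‖u τ x‖ ^ 2 *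
        max (-(fderiv ℝ (fun y => ‖u τ y‖) x (u τ x))) 0 *
          (K + (∫ σ in Ioo 0 τ, r σ) - (p τ x + ‖u τ x - U‖ ^ 2 / 2)) := by
    intro τ hτ
    have hτ' : τ ∈ Ico 0 T := ⟨hτ.1.le, hτ.2.trans ht.2⟩
    funext x
    by_cases hx : c < ‖u τ x‖
    · have hzW : (τ, x) ∈ W := ⟨mk_mem_prod hτ' (mem_univ x), hx⟩
      rw [indicator_of_mem hzW, indicator_of_mem (show x ∈ {x | c < ‖u τ x‖} from hx), hG]
      simp only [uncurry_apply_pair]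
      rw [hdn_eq τ hτ' x hx, hIr_eq τ hτ.1.le]
    · have hzW : (τ, x) ∉ W := fun h => hx h.2
      rw [indicator_of_notMem hzW, indicator_of_notMem (show x ∉ {x | c < ‖u τ x‖} from hx)]
  have hmeas : AEStronglyMeasurable (fun τ => ∫ x, {x | c < ‖u τ x‖}.indicator (fun x =>
      c / ‖u τ x‖ ^ 2 * max (-(fderiv ℝ (fun y => ‖u τ y‖) x (u τ x))) 0 *
        (K + (∫ σ in Ioo 0 τ, r σ) - (p τ x + ‖u τ x - U‖ ^ 2 / 2))) x)
      (volume.restrict (Ioo 0 t)) := by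
    refine hmeas0.congr ?_
    filter_upwards [ae_restrict_mem measurableSet_Ioo] with τ hτ
    show (∫ x, W.indicator G (τ, x)) = _
    rw [hsec τ hτ]
  -- (b) the uniform bound
  refine levelSetModeration_integrableOn_Ioo_of_bound hmeas
    (C := C₀ * (2 * VectorCalculus.kineticEnergy (u 0) / c ^ 2)) ?_
  filter_upwards [ae_restrict_mem measurableSet_Ioo] with τ hτ
  have hτ' : τ ∈ Ico 0 T := ⟨hτ.1.le, hτ.2.trans ht.2⟩
  have hτt : τ ∈ Icc 0 t := ⟨hτ.1.le, hτ.2.le⟩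
  have hτ₁ : τ ∈ Icc 0 ((t + T) / 2) := ⟨hτ.1.le, hτ.2.le.trans htT₁⟩
  obtain ⟨hVfin, hVle⟩ := levelSetModeration_toReal_volume_superlevel_le hν.le hLH
    ⟨hτ'.1, hτ'.2.le⟩ hc
  have hdiff : Differentiable ℝ (u τ) := (hcl.contDiff_velocity hτ').differentiable (by simp)
  have hbound := levelSetModeration_norm_integral_le_of_superlevel (hcl.contDiff_velocity hτ').continuous
    (C₀ := C₀) (c := c)
    (g := {x | c < ‖u τ x‖}.indicator fun x => c / ‖u τ x‖ ^ 2 *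
      max (-(fderiv ℝ (fun y => ‖u τ y‖) x (u τ x))) 0 *
        (K + (∫ σ in Ioo 0 τ, r σ) - (p τ x + ‖u τ x - U‖ ^ 2 / 2)))
    (fun x hx => by
      rw [indicator_of_mem (show x ∈ {x | c < ‖u τ x‖} from hx)]
      have hx0 : u τ x ≠ 0 := by
        intro h0; rw [h0, norm_zero] at hx; exact absurd hx (not_lt.2 hc.le)
      have hux : ‖u τ x‖ ≤ B := (hB τ hτt x).1
      have hpx : |p τ x| ≤ B := (hB τ hτt x).2.1
      have hv0 : 0 < ‖u τ x‖ := hc.trans hx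
      -- factor 1: `c/|u|² ≤ 1/c`
      have h1 : |c / ‖u τ x‖ ^ 2| ≤ 1 / c := by
        rw [abs_of_nonneg (by positivity)]
        rw [div_le_div_iff₀ (by positivity) hc]
        nlinarith [hx.le, hv0]
      -- factor 2: `(-D|u|(u))₊ ≤ L B`
      have h2 : |max (-(fderiv ℝ (fun y => ‖u τ y‖) x (u τ x))) 0| ≤ L * B := by
        rw [abs_of_nonneg (le_max_right _ _)]
        refine max_le ?_ (by positivity)
        have hh := ContinuousLinearMap.le_opNorm (fderiv ℝ (fun y => ‖u τ y‖) x) (u τ x)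
        rw [Real.norm_eq_abs] at hh
        have hD : ‖fderiv ℝ (fun y => ‖u τ y‖) x‖ ≤ L :=
          (norm_fderiv_norm_comp_le (hdiff x) hx0).trans (hL τ hτ₁ x)
        calc -(fderiv ℝ (fun y => ‖u τ y‖) x (u τ x)) ≤ |fderiv ℝ (fun y => ‖u τ y‖) x (u τ x)| :=
              neg_le_abs _
          _ ≤ ‖fderiv ℝ (fun y => ‖u τ y‖) x‖ * ‖u τ x‖ := hh
          _ ≤ L * B := mul_le_mul hD hux (norm_nonneg _) hL0
      -- factor 3
      have h3 : |K + (∫ σ in Ioo 0 τ, r σ) - (p τ x + ‖u τ x - U‖ ^ 2 / 2)| ≤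
          |K| + R * t + (B + (B + ‖U‖) ^ 2 / 2) := by
        have hq : |p τ x + ‖u τ x - U‖ ^ 2 / 2| ≤ B + (B + ‖U‖) ^ 2 / 2 := by
          have hn : ‖u τ x - U‖ ≤ B + ‖U‖ := (norm_sub_le _ _).trans (add_le_add hux le_rfl)
          have hn2 : ‖u τ x - U‖ ^ 2 / 2 ≤ (B + ‖U‖) ^ 2 / 2 := by
            gcongr
          calc |p τ x + ‖u τ x - U‖ ^ 2 / 2| ≤ |p τ x| + |‖u τ x - U‖ ^ 2 / 2| := abs_add_le _ _
            _ ≤ B + (B + ‖U‖) ^ 2 / 2 := by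
                rw [abs_of_nonneg (by positivity : (0 : ℝ) ≤ ‖u τ x - U‖ ^ 2 / 2)]
                exact add_le_add hpx hn2
        calc |K + (∫ σ in Ioo 0 τ, r σ) - (p τ x + ‖u τ x - U‖ ^ 2 / 2)|
            ≤ |K + (∫ σ in Ioo 0 τ, r σ)| + |p τ x + ‖u τ x - U‖ ^ 2 / 2| := abs_sub _ _
          _ ≤ (|K| + |∫ σ in Ioo 0 τ, r σ|) + (B + (B + ‖U‖) ^ 2 / 2) :=
              add_le_add (abs_add_le _ _) hq
          _ ≤ |K| + R * t + (B + (B + ‖U‖) ^ 2 / 2) := by linarith [hIr τ hτt]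
      rw [abs_mul, abs_mul, hC₀]
      exact mul_le_mul (mul_le_mul h1 h2 (abs_nonneg _) (by positivity)) h3 (abs_nonneg _)
        (by positivity))
    (fun x hx => indicator_of_notMem (show x ∉ {x | c < ‖u τ x‖} from hx) _) hVfin
  exact hbound.trans (mul_le_mul_of_nonneg_left hVle hC₀0)

end SliceIntegrability

/-- **Slice regularity** (registered stub `stub_sliceRegularity` of the crux item
stmt-NavierStokesRegularity-18149, line `Sketch`): on every closed slab `[0, t]`, `t < T`, of a
classical Leray–Hopf solution from a rapidly decaying datum (`ν, T > 0`), for a level `c > 0`, a frame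
`U`, a head level `K` and a continuous rate `r`: (i) the super-level sets `{c < |u(τ)|}` are bounded,
(ii) `u` and the head `p + |u - U|²/2` are bounded above, (iii) the speed-gradient slice and (iv) the
head-deficit slice are integrable in time on `(0, t)`. [cite: Tao2011, Cor. 11.1 and Lemma 4.1 (i)] -/
theorem stub_sliceRegularity :
    ∀ (ν T : ℝ) (u : ℝ → EuclideanSpace ℝ (Fin 3) → EuclideanSpace ℝ (Fin 3)) (p : ℝ → EuclideanSpace ℝ (Fin 3) → ℝ), 0 < ν → 0 < T → Literature.Analysis.FluidPDE.IsClassicalNSSolutionOn (Set.Ico 0 T) ν 0 u p → Literature.Analysis.FluidPDE.IsLerayHopfOn T ν 0 (u 0) u → Literature.Analysis.FluidPDE.HasRapidSpatialDecay (u 0) → ∀ (c t : ℝ) (U : EuclideanSpace ℝ (Fin 3)) (K : ℝ) (r : ℝ → ℝ), 0 < c → t ∈ Set.Ico 0 T → Continuous r → (∀ τ ∈ Set.Icc 0 t, Bornology.IsBounded {x | c < ‖u τ x‖}) ∧ (∃ B : ℝ, ∀ τ ∈ Set.Icc 0 t, ∀ x, ‖u τ x‖ ≤ B ∧ p τ x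 + ‖u τ x - U‖ ^ 2 / 2 ≤ B) ∧ MeasureTheory.IntegrableOn (fun τ => ∫ x, Set.indicator {x | c < ‖u τ x‖} (fun x => ‖fderiv ℝ (fun y => ‖u τ y‖) x‖) x) (Set.Ioo 0 t) ∧ MeasureTheory.IntegrableOn (fun τ => ∫ x, Set.indicator {x | c < ‖u τ x‖} (fun x => c / ‖u τ x‖ ^ 2 * max (-(fderiv ℝ (fun y => ‖u τ y‖) x (u τ x))) 0 * (K + (∫ σ in Set.Ioo 0 τ, r σ) - (p τ x + ‖u τ x - U‖ ^ 2 / 2))) x) (Set.Ioo 0 t) := by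
  intro ν T u p hν _hT hcl hLH hdec c t U K r hc ht hr
  refine ⟨fun τ hτ => ?_, ?_, ?_, ?_⟩
  · exact levelSetModeration_isBounded_superlevel ν T u p hν hcl hLH hdec τ ⟨hτ.1, hτ.2.trans_lt ht.2⟩ c hc
  · obtain ⟨B, hB⟩ := levelSetModeration_slabBounds ν T u p hν hcl hLH hdec t ht
    refine ⟨max B (B + (B + ‖U‖) ^ 2 / 2), fun τ hτ x => ⟨(hB τ hτ x).1.trans (le_max_left _ _), ?_⟩⟩
    have hux : ‖u τ x‖ ≤ B := (hB τ hτ x).1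
    have hpx : p τ x ≤ B := (le_abs_self _).trans (hB τ hτ x).2.1
    have hB0 : 0 ≤ B := (norm_nonneg _).trans hux
    have hn : ‖u τ x - U‖ ≤ B + ‖U‖ := (norm_sub_le _ _).trans (add_le_add hux le_rfl)
    have hn2 : ‖u τ x - U‖ ^ 2 / 2 ≤ (B + ‖U‖) ^ 2 / 2 := by gcongr
    exact (add_le_add hpx hn2).trans (le_max_right _ _)
  · exact levelSetModeration_integrableOn_gradSlice hν hcl hLH hdec hc ht
  · exact levelSetModeration_integrableOn_deficitSlice hν hcl hLH hdec hc ht U K hr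

end Summit.NavierStokesRegularity.NavierStokesRegularity.Theorems
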